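import Literature.Computability.QuantumComplexity.QubitChannelPointwise
import Literature.Analysis.Convexity.DinesYuan
import HarnessLib

/-!
# Kempe–Regev–Unger–de Wolf, Lemma 8: one-qubit channels contract the Pauli weight

Lemma 8 of Kempe–Regev–Unger–de Wolf, *Upper bounds on the noise threshold for fault-tolerant
quantum computing*, Quantum Inf. Comput. 10 (2010) 361–376 [KempeEtAl2010]: "For any CPTP map
`G` on one qubit there exists a `β ∈ [0,1]` such that the following holds. For any Hermitian
matrix `δ`, if we let `δ'` denote the result of applying `G` to `δ`, then
`δ̂'(X)² + δ̂'(Y)² + δ̂'(Z)² ≤ (1 − β) δ̂(I)² + β (δ̂(X)² + δ̂(Y)² + δ̂(Z)²)`."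

The channel is given by a Kraus family `K` with `Σ Kᵢᴴ Kᵢ = 1` (`G(δ) = Σ Kᵢ δ Kᵢᴴ`; every
CPTP qubit map has this form). We prove the lemma in three guises:

* `kruw_lemma8_trace` (matrix form): `∃ β ∈ [0,1]`, `Tr(G(δ)²) ≤ (1 − β)(Tr δ)² + β Tr(δ²)` for
  all Hermitian `δ` — equivalent to the printed form by the one-qubit Parseval identity
  `2 Tr(δ²) = Σ_Q δ̂(Q)²`;
* `kruw_lemma8_real` (the printed form, through the real Pauli transfer matrix
  `T_{QQ'} = ½ Re Tr(σ_Q G(σ_{Q'}))`, `δ̂'(Q) = Σ_{Q'} T_{QQ'} δ̂(Q')`);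
* `kruw_lemma8_complex`: the same inequality with `|·|²` for complex coefficient vectors (the
  form consumed slice-wise on an `n`-qubit register, where the coefficients `Tr(S δ)` of a
  non-Hermitian slice need not be real).

**Proof.** Not the printed one (Ruskai–Szarek–Werner normal form `U₁ ∘ J ∘ U₂` and
Cauchy–Schwarz), but: the two real quadratic forms `q_A(δ) = (Tr δ)² − Tr(G(δ)²)` and
`q_B(δ) = Tr(δ²) − Tr(G(δ)²)` on Hermitian `2 × 2` matrices satisfy `max(q_A, q_B) ≥ 0`
pointwise (`re_trace_kraus_sq_le_max`, the by-hand spectral decomposition), so by **Yuan's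
lemma** (`Literature.Analysis.Convexity.yuan_lemma`, via Dines' convexity of the joint range) a
convex combination `μ q_A + (1 − μ) q_B` is nonnegative; `β = 1 − μ`. The forms are realised on
the coefficient space `Pauli → ℝ` (`δ = ½ Σ_Q v_Q σ_Q`).

## References

* [KempeEtAl2010] J. Kempe, O. Regev, F. Unger, R. de Wolf, Quantum Inf. Comput. 10 (2010)
  361–376; arXiv:0802.1464, Lemma 8 (§3.1.2, Case 2) and §2.
* Y. Yuan, Math. Programming 47 (1990) 53–63, Lemma 2.3; I. Pólik, T. Terlaky, SIAM Review 49
  (2007), Lemma 2.7 (as proved in `Literature/Analysis/Convexity/DinesYuan.lean`).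
-/

noncomputable section

open Matrix Finset
open scoped ComplexOrder MatrixOrder

namespace Literature.Computability.QuantumComplexity

variable {κ : Type*} [Fintype κ]

/-! ### The Hermitian matrix with prescribed real Pauli coefficients -/

/-- `½ Σ_Q v_Q σ_Q` is Hermitian for real `v`. [cite: KempeEtAl2010, §2] -/
theorem isHermitian_half_sum_smul_mat (v : Pauli → ℝ) :
    ((1 / 2 : ℂ) • ∑ Q, ((v Q : ℝ) : ℂ) • Pauli.mat Q).IsHermitian := by
  unfold Matrix.IsHermitian
  rw [conjTranspose_smul, conjTranspose_sum]
  have h2 : star (1 / 2 : ℂ) = 1 / 2 := by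
    rw [Complex.star_def, map_div₀, map_one, map_ofNat]
  rw [h2]
  congr 1
  refine Finset.sum_congr rfl fun Q _ => ?_
  rw [conjTranspose_smul, Pauli.conjTranspose_mat, Complex.star_def, Complex.conj_ofReal]

/-- The Pauli coefficients of `½ Σ_Q v_Q σ_Q` are the `v_Q` (orthogonality).
[cite: KempeEtAl2010, §2 (δ̂(S) = Tr(δ S))] -/
theorem trace_mat_mul_half_sum_smul_mat (v : Pauli → ℂ) (Q : Pauli) :
    (Pauli.mat Q * ((1 / 2 : ℂ) • ∑ Q', v Q' • Pauli.mat Q')).trace = v Q := by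
  simp only [Matrix.mul_smul, Matrix.mul_sum, trace_smul, trace_sum, smul_eq_mul,
    Pauli.trace_mat_mul_mat, mul_ite, mul_zero, Finset.sum_ite_eq, Finset.mem_univ, if_true]
  ring

/-- A Kraus map applied to `½ Σ_Q v_Q σ_Q`, expanded. [folklore] -/
theorem kraus_half_sum_smul_mat (K : κ → Matrix Bool Bool ℂ) (v : Pauli → ℂ) :
    ∑ i, K i * ((1 / 2 : ℂ) • ∑ Q', v Q' • Pauli.mat Q') * (K i)ᴴ =
      (1 / 2 : ℂ) • ∑ Q', v Q' • ∑ i, K i * Pauli.mat Q' * (K i)ᴴ := by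
  rw [kraus_smul]
  congr 1
  simp only [Matrix.mul_sum, Matrix.sum_mul, Matrix.mul_smul, Matrix.smul_mul, Finset.smul_sum]
  rw [Finset.sum_comm]

/-- For Hermitian `σ_Q` and the Hermitian image `G(σ_{Q'})`, `Tr(σ_Q G(σ_{Q'}))` is real: the
Pauli transfer matrix of a channel is real. [cite: KempeEtAl2010, Lemma 8 (J in the Pauli basis)] -/
theorem trace_mat_mul_kraus_mat_im (K : κ → Matrix Bool Bool ℂ) (Q Q' : Pauli) :
    (Pauli.mat Q * ∑ i, K i * Pauli.mat Q' * (K i)ᴴ).trace.im = 0 :=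
  trace_mul_im_of_isHermitian (Pauli.conjTranspose_mat Q)
    (isHermitian_kraus K (Pauli.conjTranspose_mat Q'))

/-- The coefficients of `G(½ Σ v_Q σ_Q)` through the transfer matrix:
`Tr(σ_Q G(δ)) = Σ_{Q'} (½ Tr(σ_Q G(σ_{Q'}))) v_{Q'}`. [cite: KempeEtAl2010, Lemma 8 (G in the Pauli basis)] -/
theorem trace_mat_mul_kraus_half_sum (K : κ → Matrix Bool Bool ℂ) (v : Pauli → ℂ) (Q : Pauli) :
    (Pauli.mat Q * ∑ i, K i * ((1 / 2 : ℂ) • ∑ Q', v Q' • Pauli.mat Q') * (K i)ᴴ).trace =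
      ∑ Q', (Pauli.mat Q * ∑ i, K i * Pauli.mat Q' * (K i)ᴴ).trace / 2 * v Q' := by
  rw [kraus_half_sum_smul_mat]
  simp only [Matrix.mul_smul, trace_smul, trace_sum, smul_eq_mul, Finset.mul_sum]
  refine Finset.sum_congr rfl fun Q' _ => ?_
  rw [Finset.sum_div, Finset.sum_mul]
  refine Finset.sum_congr rfl fun i _ => ?_
  ring

/-! ### The real Pauli transfer matrix -/

/-- The coefficients of `G(½ Σ v_Q σ_Q)` for real `v` through the **real** transfer matrix
`T_{QQ'} = ½ Re Tr(σ_Q G(σ_{Q'}))`: `Tr(σ_Q G(δ)) = Σ_{Q'} T_{QQ'} v_{Q'}`.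
[cite: KempeEtAl2010, Lemma 8 (G in the Pauli basis)] -/
theorem trace_mat_mul_kraus_half_sum_real (K : κ → Matrix Bool Bool ℂ) (v : Pauli → ℝ) (Q : Pauli) :
    (Pauli.mat Q * ∑ i, K i * ((1 / 2 : ℂ) • ∑ Q', ((v Q' : ℝ) : ℂ) • Pauli.mat Q') * (K i)ᴴ).trace =
      ((∑ Q', (Pauli.mat Q * ∑ i, K i * Pauli.mat Q' * (K i)ᴴ).trace.re / 2 * v Q' : ℝ) : ℂ) := by
  rw [trace_mat_mul_kraus_half_sum]
  push_cast
  refine Finset.sum_congr rfl fun Q' _ => ?_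
  congr 2
  apply Complex.ext
  · simp
  · simp [trace_mat_mul_kraus_mat_im]

/-- One-qubit Parseval for `δ = ½ Σ v_Q σ_Q`: `Tr(δ²) = ½ Σ_Q v_Q²`. [cite: KempeEtAl2010, §2] -/
theorem re_trace_half_sum_sq (v : Pauli → ℝ) :
    (((1 / 2 : ℂ) • ∑ Q, ((v Q : ℝ) : ℂ) • Pauli.mat Q) *
      ((1 / 2 : ℂ) • ∑ Q, ((v Q : ℝ) : ℂ) • Pauli.mat Q)).trace.re =
      (1 / 2) * (v Pauli.I ^ 2 + v Pauli.X ^ 2 + v Pauli.Y ^ 2 + v Pauli.Z ^ 2) := by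
  rw [trace_mul_self_eq_half_sum_sq]
  simp only [trace_mat_mul_half_sum_smul_mat]
  have : ((1 / 2 : ℂ) * ∑ Q, ((v Q : ℝ) : ℂ) ^ 2) = (((1 / 2) * ∑ Q, v Q ^ 2 : ℝ) : ℂ) := by
    push_cast; rfl
  rw [this, Complex.ofReal_re, Pauli.sum_univ]

/-- One-qubit Parseval for the image: `Tr(G(δ)²) = ½ Σ_Q (Σ_{Q'} T_{QQ'} v_{Q'})²`.
[cite: KempeEtAl2010, §2 and Lemma 8] -/
theorem re_trace_kraus_half_sum_sq (K : κ → Matrix Bool Bool ℂ) (v : Pauli → ℝ) :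
    ((∑ i, K i * ((1 / 2 : ℂ) • ∑ Q', ((v Q' : ℝ) : ℂ) • Pauli.mat Q') * (K i)ᴴ) *
      (∑ i, K i * ((1 / 2 : ℂ) • ∑ Q', ((v Q' : ℝ) : ℂ) • Pauli.mat Q') * (K i)ᴴ)).trace.re =
      (1 / 2) * (
        (∑ Q', (Pauli.mat Pauli.I * ∑ i, K i * Pauli.mat Q' * (K i)ᴴ).trace.re / 2 * v Q') ^ 2 +
        (∑ Q', (Pauli.mat Pauli.X * ∑ i, K i * Pauli.mat Q' * (K i)ᴴ).trace.re / 2 * v Q') ^ 2 +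
        (∑ Q', (Pauli.mat Pauli.Y * ∑ i, K i * Pauli.mat Q' * (K i)ᴴ).trace.re / 2 * v Q') ^ 2 +
        (∑ Q', (Pauli.mat Pauli.Z * ∑ i, K i * Pauli.mat Q' * (K i)ᴴ).trace.re / 2 * v Q') ^ 2) := by
  rw [trace_mul_self_eq_half_sum_sq]
  simp only [trace_mat_mul_kraus_half_sum_real]
  set r : Pauli → ℝ := fun Q => ∑ Q', (Pauli.mat Q * ∑ i, K i * Pauli.mat Q' * (K i)ᴴ).trace.re / 2 *
    v Q' with hr
  change ((1 / 2 : ℂ) * ∑ Q, ((r Q : ℝ) : ℂ) ^ 2).re = (1 / 2) * (r .I ^ 2 + r .X ^ 2 + r .Y ^ 2 + r .Z ^ 2)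
  have : ((1 / 2 : ℂ) * ∑ Q, ((r Q : ℝ) : ℂ) ^ 2) = (((1 / 2) * ∑ Q, r Q ^ 2 : ℝ) : ℂ) := by
    push_cast; rfl
  rw [this, Complex.ofReal_re, Pauli.sum_univ]

/-- The trace of `δ = ½ Σ v_Q σ_Q` is `v_I`. [cite: KempeEtAl2010, §2] -/
theorem re_trace_half_sum (v : Pauli → ℝ) :
    ((1 / 2 : ℂ) • ∑ Q, ((v Q : ℝ) : ℂ) • Pauli.mat Q).trace.re = v Pauli.I := by
  have h := trace_mat_mul_half_sum_smul_mat (fun Q => ((v Q : ℝ) : ℂ)) Pauli.I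
  rw [show Pauli.mat Pauli.I = 1 from rfl, Matrix.one_mul] at h
  rw [h, Complex.ofReal_re]

/-- Trace preservation in the Pauli basis: the `I`-row of the transfer matrix is `(1,0,0,0)`,
`Σ_{Q'} T_{IQ'} v_{Q'} = v_I`. [cite: KempeEtAl2010, Lemma 8 (first row of J)] -/
theorem transfer_row_I (K : κ → Matrix Bool Bool ℂ) (hK : ∑ i, (K i)ᴴ * K i = 1) (v : Pauli → ℝ) :
    ∑ Q', (Pauli.mat Pauli.I * ∑ i, K i * Pauli.mat Q' * (K i)ᴴ).trace.re / 2 * v Q' = v Pauli.I := by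
  have h := trace_mat_mul_kraus_half_sum_real K v Pauli.I
  rw [show Pauli.mat Pauli.I = 1 from rfl, Matrix.one_mul, trace_kraus K hK] at h
  have h' := congrArg Complex.re h
  rw [re_trace_half_sum, Complex.ofReal_re] at h'
  rw [show Pauli.mat Pauli.I = 1 from rfl]
  exact h'.symm

/-! ### Lemma 8 -/

/-- **Lemma 8 (Kempe–Regev–Unger–de Wolf), printed form.** For every one-qubit Kraus channel
`G` (Kraus family `K`, `Σ Kᵢᴴ Kᵢ = 1`) there is `β ∈ [0,1]` such that for every real
coefficient vector `v` (the Pauli coefficients `δ̂(Q)` of a Hermitian `δ`), writing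
`δ̂'(Q) = Σ_{Q'} T_{QQ'} v_{Q'}` with the real transfer matrix `T_{QQ'} = ½ Re Tr(σ_Q G(σ_{Q'}))`
for the coefficients of `δ' = G(δ)`:
`δ̂'(X)² + δ̂'(Y)² + δ̂'(Z)² ≤ (1 − β) v_I² + β (v_X² + v_Y² + v_Z²)`.
[cite: KempeEtAl2010, Lemma 8] -/
theorem kruw_lemma8_real (K : κ → Matrix Bool Bool ℂ) (hK : ∑ i, (K i)ᴴ * K i = 1) :
    ∃ β : ℝ, 0 ≤ β ∧ β ≤ 1 ∧ ∀ v : Pauli → ℝ,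
      (∑ Q', (Pauli.mat Pauli.X * ∑ i, K i * Pauli.mat Q' * (K i)ᴴ).trace.re / 2 * v Q') ^ 2 +
      (∑ Q', (Pauli.mat Pauli.Y * ∑ i, K i * Pauli.mat Q' * (K i)ᴴ).trace.re / 2 * v Q') ^ 2 +
      (∑ Q', (Pauli.mat Pauli.Z * ∑ i, K i * Pauli.mat Q' * (K i)ᴴ).trace.re / 2 * v Q') ^ 2 ≤
        (1 - β) * v Pauli.I ^ 2 + β * (v Pauli.X ^ 2 + v Pauli.Y ^ 2 + v Pauli.Z ^ 2) := by
  classical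
  -- the real transfer matrix and the three quadratic forms on `Pauli → ℝ`
  set t : Pauli → (Pauli → ℝ) →ₗ[ℝ] ℝ := fun Q =>
    ∑ Q', ((Pauli.mat Q * ∑ i, K i * Pauli.mat Q' * (K i)ᴴ).trace.re / 2) • LinearMap.proj Q'
    with ht
  set p : Pauli → (Pauli → ℝ) →ₗ[ℝ] ℝ := fun Q => LinearMap.proj Q with hp
  set qT : QuadraticForm ℝ (Pauli → ℝ) := QuadraticMap.linMulLin (t .X) (t .X) +
    QuadraticMap.linMulLin (t .Y) (t .Y) + QuadraticMap.linMulLin (t .Z) (t .Z) with hqT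
  set qS : QuadraticForm ℝ (Pauli → ℝ) := QuadraticMap.linMulLin (p .X) (p .X) +
    QuadraticMap.linMulLin (p .Y) (p .Y) + QuadraticMap.linMulLin (p .Z) (p .Z) with hqS
  set qI : QuadraticForm ℝ (Pauli → ℝ) := QuadraticMap.linMulLin (p .I) (p .I) with hqI
  have ht_apply : ∀ Q v, t Q v =
      ∑ Q', (Pauli.mat Q * ∑ i, K i * Pauli.mat Q' * (K i)ᴴ).trace.re / 2 * v Q' := fun Q v => by
    simp [ht, LinearMap.sum_apply]
  have hqT_apply : ∀ v, qT v = t .X v ^ 2 + t .Y v ^ 2 + t .Z v ^ 2 := fun v => by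
    simp only [hqT, QuadraticMap.add_apply, QuadraticMap.linMulLin_apply, sq]
  have hqS_apply : ∀ v, qS v = v .X ^ 2 + v .Y ^ 2 + v .Z ^ 2 := fun v => by
    simp only [hqS, hp, QuadraticMap.add_apply, QuadraticMap.linMulLin_apply, LinearMap.proj_apply,
      sq]
  have hqI_apply : ∀ v, qI v = v .I ^ 2 := fun v => by
    simp only [hqI, hp, QuadraticMap.linMulLin_apply, LinearMap.proj_apply, sq]
  have htI : ∀ v, t .I v = v .I := fun v => by rw [ht_apply]; exact transfer_row_I K hK v
  -- the pointwise alternative, from the matrix bound for `δ = ½ Σ v_Q σ_Q`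
  have hpt : ∀ v, 0 ≤ (qI - qT) v ∨ 0 ≤ (qS - qT) v := by
    intro v
    have hmax := re_trace_kraus_sq_le_max K hK (isHermitian_half_sum_smul_mat v)
    rw [re_trace_kraus_half_sum_sq, re_trace_half_sum_sq, re_trace_half_sum,
      transfer_row_I K hK] at hmax
    simp only [QuadraticMap.sub_apply, hqT_apply, hqS_apply, hqI_apply, ht_apply, sub_nonneg]
    rcases le_max_iff.1 hmax with h | h
    · left; linarith
    · right; linarith
  obtain ⟨μ, hμ0, hμ1, hμ⟩ := Literature.Analysis.Convexity.yuan_lemma (qI - qT) (qS - qT) hpt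
  refine ⟨1 - μ, by linarith, by linarith, fun v => ?_⟩
  have hμv := hμ v
  simp only [QuadraticMap.sub_apply, hqT_apply, hqS_apply, hqI_apply, ht_apply] at hμv
  nlinarith

/-- **Lemma 8, matrix form.** For a one-qubit Kraus channel there is `β ∈ [0, 1]` with
`Tr(G(δ)²) ≤ (1 − β)(Tr δ)² + β Tr(δ²)` for every Hermitian `2 × 2` matrix `δ` (equivalent to
the printed form by `2 Tr(δ²) = Σ_Q δ̂(Q)²`). [cite: KempeEtAl2010, Lemma 8] -/
theorem kruw_lemma8_trace (K : κ → Matrix Bool Bool ℂ) (hK : ∑ i, (K i)ᴴ * K i = 1) :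
    ∃ β : ℝ, 0 ≤ β ∧ β ≤ 1 ∧ ∀ δ : Matrix Bool Bool ℂ, δ.IsHermitian →
      ((∑ i, K i * δ * (K i)ᴴ) * (∑ i, K i * δ * (K i)ᴴ)).trace.re ≤
        (1 - β) * δ.trace.re ^ 2 + β * (δ * δ).trace.re := by
  obtain ⟨β, hβ0, hβ1, hβ⟩ := kruw_lemma8_real K hK
  refine ⟨β, hβ0, hβ1, fun δ hδ => ?_⟩
  -- write `δ = ½ Σ v_Q σ_Q` with `v_Q = Tr(σ_Q δ)` (real)
  set v : Pauli → ℝ := fun Q => (Pauli.mat Q * δ).trace.re with hv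
  have hvC : ∀ Q, ((v Q : ℝ) : ℂ) = (Pauli.mat Q * δ).trace := by
    intro Q
    apply Complex.ext
    · simp [hv]
    · rw [Complex.ofReal_im, trace_mul_im_of_isHermitian (Pauli.conjTranspose_mat Q) hδ]
  have hδv : δ = (1 / 2 : ℂ) • ∑ Q, ((v Q : ℝ) : ℂ) • Pauli.mat Q := by
    simp only [hvC]
    exact Pauli.eq_half_sum_trace_smul δ
  have h := hβ v
  rw [hδv, re_trace_kraus_half_sum_sq, re_trace_half_sum_sq, re_trace_half_sum, transfer_row_I K hK]
  nlinarith

/-- **Lemma 8, complex coefficients.** The same `β` bounds complex coefficient vectors, with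
the complex transfer matrix `½ Tr(σ_Q G(σ_{Q'}))` (which is real) and `|·|²` in place of squares:
`Σ_{Q ∈ {X,Y,Z}} |Σ_{Q'} T_{QQ'} v_{Q'}|² ≤ (1 − β) |v_I|² + β (|v_X|² + |v_Y|² + |v_Z|²)`.
This is the form used slice-wise on an `n`-qubit register (apply the real form to `Re v` and
`Im v` and add). [cite: KempeEtAl2010, Lemma 8] -/
theorem kruw_lemma8_complex (K : κ → Matrix Bool Bool ℂ) (hK : ∑ i, (K i)ᴴ * K i = 1) :
    ∃ β : ℝ, 0 ≤ β ∧ β ≤ 1 ∧ ∀ v : Pauli → ℂ,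
      ‖∑ Q', (Pauli.mat Pauli.X * ∑ i, K i * Pauli.mat Q' * (K i)ᴴ).trace / 2 * v Q'‖ ^ 2 +
      ‖∑ Q', (Pauli.mat Pauli.Y * ∑ i, K i * Pauli.mat Q' * (K i)ᴴ).trace / 2 * v Q'‖ ^ 2 +
      ‖∑ Q', (Pauli.mat Pauli.Z * ∑ i, K i * Pauli.mat Q' * (K i)ᴴ).trace / 2 * v Q'‖ ^ 2 ≤
        (1 - β) * ‖v Pauli.I‖ ^ 2 + β * (‖v Pauli.X‖ ^ 2 + ‖v Pauli.Y‖ ^ 2 + ‖v Pauli.Z‖ ^ 2) := by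
  obtain ⟨β, hβ0, hβ1, hβ⟩ := kruw_lemma8_real K hK
  refine ⟨β, hβ0, hβ1, fun v => ?_⟩
  -- the complex transfer matrix is the real one
  have hT : ∀ Q Q', (Pauli.mat Q * ∑ i, K i * Pauli.mat Q' * (K i)ᴴ).trace / 2 =
      (((Pauli.mat Q * ∑ i, K i * Pauli.mat Q' * (K i)ᴴ).trace.re / 2 : ℝ) : ℂ) := by
    intro Q Q'
    apply Complex.ext
    · simp
    · simp [trace_mat_mul_kraus_mat_im]
  -- split `v` into real and imaginary parts
  have hsplit : ∀ Q, ‖∑ Q', (Pauli.mat Q * ∑ i, K i * Pauli.mat Q' * (K i)ᴴ).trace / 2 * v Q'‖ ^ 2 =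
      (∑ Q', (Pauli.mat Q * ∑ i, K i * Pauli.mat Q' * (K i)ᴴ).trace.re / 2 * (v Q').re) ^ 2 +
      (∑ Q', (Pauli.mat Q * ∑ i, K i * Pauli.mat Q' * (K i)ᴴ).trace.re / 2 * (v Q').im) ^ 2 := by
    intro Q
    simp only [hT]
    rw [Complex.sq_norm, Complex.normSq_apply, Complex.re_sum, Complex.im_sum]
    simp only [Complex.re_ofReal_mul, Complex.im_ofReal_mul]
    ring
  have hnorm : ∀ Q, ‖v Q‖ ^ 2 = (v Q).re ^ 2 + (v Q).im ^ 2 := fun Q => by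
    rw [Complex.sq_norm, Complex.normSq_apply]; ring
  have h1 := hβ fun Q => (v Q).re
  have h2 := hβ fun Q => (v Q).im
  simp only [hsplit, hnorm]
  linarith

end Literature.Computability.QuantumComplexity
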